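import Mathlib.Analysis.Calculus.Deriv.MeanValue
import Mathlib.MeasureTheory.Integral.IntervalIntegral.FundThmCalculus
import HarnessLib

/-!
# Bond heat uncertainty — energy window: three INTERPOLATION INEQUALITIES on an interval
  (rungs (C2a), (C2b), (C2c) beneath the open leaf (COF))

Cell `decomp-a2c`, lens-1 «grading / quantitative ladder», generation 84, crux
`stmt-AtomisticToContinuum-9121` (`ExtensiveSnapshotIrreversibility`, K_fix half, leaf S3), part N.
Pure real analysis, no chain: the one-dimensional interpolation inequalities that drive the
SITE TRANSFER proof of (COF) planned in memo NODE-g84 §5.  Along a driven path the costate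
`c = (α, β)` is only `C²` in time (the momenta are not differentiable), so smallness of the observed
component `β_0` cannot be transported to the other components by differentiating; it is
transported by these two inequalities instead, in which every PATH-dependent quantity enters
through a time integral (budget currency) and every COSTATE quantity through a `sup`:

* `sq_mul_le_integral_sq` / `abs_pow_three_le_of_lipschitz_of_integral_sq` — **(C2a) `sup` from
  `L²` and a Lipschitz constant**: if `|f(t) - f(u)| ≤ L|t - u|` on `[a, b]` then for every
  `t ∈ [a, b]` either `|f(t)|³ ≤ 8 L ∫ₐᵇ f²` or `|f(t)|² (b - a) ≤ 8 ∫ₐᵇ f²`;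
* `half_mul_le_of_deriv_ge` / `abs_deriv_pow_three_le_of_abs_le_of_holder` — **(C2b) the
  derivative from the function and a Hölder-½ modulus of the derivative**: if `|f| ≤ ε` on
  `[a, b]`, `f' = g` on `(a, b)` and `|g(t) - g(u)| ≤ M √|t - u|` on `[a, b]`, then for every
  `t ∈ [a, b]` either `|g(t)|³ ≤ 16 ε M²` or `|g(t)| (b - a) ≤ 8 ε`.

* `sq_integral_le_mul_integral_sq` / `abs_sub_le_sqrt_integral_sq_mul_sqrt` — **(C2c) the
  Hölder-½ modulus from an `L²` bound of the derivative**: if `G' = h` on `(a, b)` then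
  `|G(x) - G(y)| ≤ √(∫ₐᵇ h²) √|x - y|` (Cauchy–Schwarz), the input of (C2b).

All three are proved from first principles (a sub-interval of guaranteed size on which `|f| ≥ |f(t)|/2`,
resp. `g ≥ g(t)/2`, then the integral, resp. the mean-value inequality
`Convex.mul_sub_le_image_sub_of_le_deriv`).  In the transfer step of (COF) the Lipschitz constant
of `β_{j+1}` is `≤ (1 + 2γ) sup‖c‖` (constant coefficients) and the Hölder-½ moduli of `β̇_j`,
`α̇_j` come from `L²` bounds of `β̈_j`, `α̈_j`, which are time INTEGRALS of polynomials of the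
path energy — see memo NODE-g84 §5 (g85 plan).

References: folklore (Landau–Kolmogorov type inequalities on a finite interval).
-/

namespace Summit.AtomisticToContinuum.FouriersLaw.Theorems.ExtensiveSnapshotIrreversibility.EnergyWindow

open MeasureTheory Set

/-! ## 1. (C2a): the `sup` from the `L²` norm and a Lipschitz constant -/

/-- If `|f| ≥ m/2 ≥ 0` on `[x, x + δ] ⊆ [a, b]` (`f` continuous on `[a, b]`), then
`(m/2)² δ ≤ ∫ₐᵇ f²`. [folklore] -/
theorem sq_mul_le_integral_sq {f : ℝ → ℝ} {a b x δ m : ℝ} (hf : ContinuousOn f (Icc a b))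
    (hax : a ≤ x) (hδ : 0 ≤ δ) (hxb : x + δ ≤ b) (hm0 : 0 ≤ m)
    (hm : ∀ u ∈ Icc x (x + δ), m / 2 ≤ |f u|) :
    (m / 2) ^ 2 * δ ≤ ∫ u in a..b, f u ^ 2 := by
  have hab : a ≤ b := by linarith
  have hfi : IntervalIntegrable (fun u => f u ^ 2) volume a b :=
    (hf.pow 2).intervalIntegrable_of_Icc hab
  have hfi' : IntervalIntegrable (fun u => f u ^ 2) volume x (x + δ) :=
    ((hf.pow 2).mono (Icc_subset_Icc hax hxb)).intervalIntegrable_of_Icc (by linarith)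
  calc (m / 2) ^ 2 * δ = ∫ _u in x..(x + δ), (m / 2) ^ 2 := by
        rw [intervalIntegral.integral_const, smul_eq_mul]; ring
    _ ≤ ∫ u in x..(x + δ), f u ^ 2 :=
        intervalIntegral.integral_mono_on (by linarith) intervalIntegrable_const hfi' fun u hu => by
          have h := pow_le_pow_left₀ (by linarith) (hm u hu) 2
          rwa [sq_abs] at h
    _ ≤ ∫ u in a..b, f u ^ 2 :=
        intervalIntegral.integral_mono_interval hax (by linarith) hxb
          (Filter.Eventually.of_forall fun u => sq_nonneg (f u)) hfi

/-- The two-sided core of (C2a): if `f` is `L`-Lipschitz on `[a, b]`, `t ∈ [a, b]`,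
`0 ≤ d ≤ (b - a)/2` and `L d ≤ |f(t)|/2`, then `(|f(t)|/2)² d ≤ ∫ₐᵇ f²` (use the side of `t` that
has room `d`). [folklore] -/
theorem sq_mul_le_integral_sq_of_lipschitz {f : ℝ → ℝ} {a b L d : ℝ} (hf : ContinuousOn f (Icc a b))
    (hlip : ∀ t ∈ Icc a b, ∀ u ∈ Icc a b, |f t - f u| ≤ L * |t - u|) (hL : 0 ≤ L) {t : ℝ}
    (ht : t ∈ Icc a b) (hd0 : 0 ≤ d) (hd : d ≤ (b - a) / 2) (hLd : L * d ≤ |f t| / 2) :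
    (|f t| / 2) ^ 2 * d ≤ ∫ u in a..b, f u ^ 2 := by
  -- on a window of size `d` around `t`, `|f| ≥ |f t| / 2`
  have hnear : ∀ u ∈ Icc a b, |t - u| ≤ d → |f t| / 2 ≤ |f u| := by
    intro u hu htu
    have h1 : |f t| - |f u| ≤ L * |t - u| := (abs_sub_abs_le_abs_sub _ _).trans (hlip t ht u hu)
    have h2 : L * |t - u| ≤ L * d := mul_le_mul_of_nonneg_left htu hL
    linarith
  by_cases hside : t + d ≤ b
  · exact sq_mul_le_integral_sq hf ht.1 hd0 hside (abs_nonneg _) fun u hu =>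
      hnear u ⟨ht.1.trans hu.1, hu.2.trans hside⟩
        (by rw [abs_of_nonpos (by linarith [hu.1])]; linarith [hu.2])
  · push Not at hside
    have hxa : a ≤ t - d := by linarith [ht.2]
    have h := sq_mul_le_integral_sq (x := t - d) hf hxa hd0 (by linarith [ht.2]) (abs_nonneg (f t))
      fun u hu => hnear u ⟨hxa.trans hu.1, by linarith [hu.2, ht.2]⟩
        (by rw [abs_of_nonneg (by linarith [hu.2])]; linarith [hu.1])
    exact h

/-- **(C2a) — the `sup` from `L²` and a Lipschitz constant.**  If `f` is continuous and
`L`-Lipschitz on `[a, b]` (`a < b`), then for every `t ∈ [a, b]`: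
`|f(t)|³ ≤ 8 L ∫ₐᵇ f²` or `|f(t)|² (b - a) ≤ 8 ∫ₐᵇ f²`. [folklore · rung (C2a) beneath (COF)] -/
theorem abs_pow_three_le_of_lipschitz_of_integral_sq {f : ℝ → ℝ} {a b L : ℝ} (hab : a < b)
    (hf : ContinuousOn f (Icc a b)) (hL : 0 ≤ L)
    (hlip : ∀ t ∈ Icc a b, ∀ u ∈ Icc a b, |f t - f u| ≤ L * |t - u|) {t : ℝ} (ht : t ∈ Icc a b) :
    |f t| ^ 3 ≤ 8 * L * ∫ u in a..b, f u ^ 2 ∨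
      |f t| ^ 2 * (b - a) ≤ 8 * ∫ u in a..b, f u ^ 2 := by
  set m := |f t| with hm
  have hm0 : 0 ≤ m := abs_nonneg _
  by_cases hcase : L * ((b - a) / 2) ≤ m / 2
  · -- the whole half-interval fits: second alternative
    right
    have h := sq_mul_le_integral_sq_of_lipschitz hf hlip hL ht (by linarith) le_rfl hcase
    nlinarith [h]
  · -- `d = m / (2L)` with `L > 0`: first alternative
    left
    push Not at hcase
    have hLpos : 0 < L := by
      by_contra h
      have hL0 : L = 0 := le_antisymm (not_lt.1 h) hL
      rw [hL0, zero_mul] at hcase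
      linarith
    have hdlt : m / (2 * L) ≤ (b - a) / 2 := by
      rw [div_le_iff₀ (by positivity)]; nlinarith
    have hLd : L * (m / (2 * L)) ≤ m / 2 := by
      rw [mul_div_assoc']
      rw [div_le_iff₀ (by positivity)]; nlinarith
    have h := sq_mul_le_integral_sq_of_lipschitz hf hlip hL ht (by positivity) hdlt hLd
    -- `(m/2)² · m/(2L) = m³/(8L) ≤ ∫ f²`
    have h8 : m ^ 3 = 8 * L * ((m / 2) ^ 2 * (m / (2 * L))) := by
      field_simp
      ring
    rw [h8]
    exact mul_le_mul_of_nonneg_left h (by positivity)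

/-! ## 2. (C2b): the derivative from the function and a Hölder-½ modulus of the derivative -/

/-- One-sided core of (C2b): if `f' = g` on `(a, b)`, `|f| ≤ ε` on `[a, b]`, `t ∈ [a, b]`,
`0 ≤ δ ≤ (b - a)/2` and `g ≥ C ≥ 0` on every point of `[a, b]` within `δ` of `t`, then `C δ ≤ 2ε`
(mean-value inequality on the side of `t` that has room `δ`). [folklore] -/
theorem mul_le_two_mul_of_deriv_ge {f g : ℝ → ℝ} {a b ε C δ : ℝ} (hf : ContinuousOn f (Icc a b))
    (hfg : ∀ x ∈ Ioo a b, HasDerivAt f (g x) x) (hε : ∀ x ∈ Icc a b, |f x| ≤ ε) {t : ℝ}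
    (ht : t ∈ Icc a b) (hδ0 : 0 ≤ δ) (hδ : δ ≤ (b - a) / 2)
    (hC : ∀ x ∈ Icc a b, |t - x| ≤ δ → C ≤ g x) : C * δ ≤ 2 * ε := by
  -- mean-value inequality on a sub-interval `[p, p + δ] ⊆ [a, b]` on which `g ≥ C`
  have key : ∀ p : ℝ, a ≤ p → p + δ ≤ b → (∀ x ∈ Icc p (p + δ), |t - x| ≤ δ) → C * δ ≤ 2 * ε := by
    intro p hap hpb hwin
    have hsub : Icc p (p + δ) ⊆ Icc a b := Icc_subset_Icc hap hpb
    have hdiff : DifferentiableOn ℝ f (interior (Icc p (p + δ))) := by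
      rw [interior_Icc]
      intro x hx
      exact (hfg x ⟨lt_of_le_of_lt hap hx.1, lt_of_lt_of_le hx.2 hpb⟩).differentiableAt.differentiableWithinAt
    have hge : ∀ x ∈ interior (Icc p (p + δ)), C ≤ deriv f x := by
      rw [interior_Icc]
      intro x hx
      rw [(hfg x ⟨lt_of_le_of_lt hap hx.1, lt_of_lt_of_le hx.2 hpb⟩).deriv]
      exact hC x (hsub (Ioo_subset_Icc_self hx)) (hwin x (Ioo_subset_Icc_self hx))
    have hmv := (convex_Icc p (p + δ)).mul_sub_le_image_sub_of_le_deriv (hf.mono hsub) hdiff hge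
      p (left_mem_Icc.2 (by linarith)) (p + δ) (right_mem_Icc.2 (by linarith)) (by linarith)
    have h1 := hε (p + δ) (hsub (right_mem_Icc.2 (by linarith)))
    have h2 := hε p (hsub (left_mem_Icc.2 (by linarith)))
    have h3 : f (p + δ) - f p ≤ 2 * ε := by
      linarith [(abs_le.1 h1).2, (abs_le.1 h2).1]
    have h4 : C * (p + δ - p) = C * δ := by ring
    linarith [hmv]
  by_cases hside : t + δ ≤ b
  · exact key t ht.1 hside fun x hx => by
      rw [abs_of_nonpos (by linarith [hx.1])]; linarith [hx.2]
  · push Not at hside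
    exact key (t - δ) (by linarith [ht.2]) (by linarith [ht.2]) fun x hx => by
      rw [abs_of_nonneg (by linarith [hx.2])]; linarith [hx.1]

/-- (C2b) for a POSITIVE value of the derivative: under the hypotheses of
`abs_deriv_pow_three_le_of_abs_le_of_holder` and `0 < g(t)`,
`g(t)³ ≤ 16 ε M²` or `g(t) (b - a) ≤ 8 ε`. [folklore] -/
theorem deriv_pow_three_le_of_abs_le_of_holder_of_pos {f g : ℝ → ℝ} {a b ε M : ℝ} (hab : a < b)
    (hM : 0 ≤ M) (hf : ContinuousOn f (Icc a b)) (hfg : ∀ x ∈ Ioo a b, HasDerivAt f (g x) x)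
    (hε : ∀ x ∈ Icc a b, |f x| ≤ ε)
    (hmod : ∀ x ∈ Icc a b, ∀ y ∈ Icc a b, |g x - g y| ≤ M * √|x - y|) {t : ℝ} (ht : t ∈ Icc a b)
    (hpos : 0 < g t) :
    g t ^ 3 ≤ 16 * ε * M ^ 2 ∨ g t * (b - a) ≤ 8 * ε := by
  set d := g t with hd
  -- within `δ` of `t`, `g ≥ d - M √δ`
  have hnear : ∀ δ : ℝ, 0 ≤ δ → M * √δ ≤ d / 2 → ∀ x ∈ Icc a b, |t - x| ≤ δ → d / 2 ≤ g x := by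
    intro δ hδ0 hMδ x hx htx
    have h1 : |g t - g x| ≤ M * √|t - x| := hmod t ht x hx
    have h2 : M * √|t - x| ≤ M * √δ := mul_le_mul_of_nonneg_left (Real.sqrt_le_sqrt htx) hM
    have h3 := (abs_le.1 (h1.trans h2)).2
    rw [← hd] at h3
    linarith
  by_cases hcase : M * √((b - a) / 2) ≤ d / 2
  · -- the whole half-interval fits: second alternative
    right
    have h := mul_le_two_mul_of_deriv_ge hf hfg hε ht (by linarith) le_rfl
      (hnear _ (by linarith) hcase)
    nlinarith [h]
  · -- `δ = (d / (2M))²` with `M > 0`: first alternative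
    left
    push Not at hcase
    have hMpos : 0 < M := by
      by_contra h
      have hM0 : M = 0 := le_antisymm (not_lt.1 h) hM
      rw [hM0, zero_mul] at hcase
      linarith
    set δ := (d / (2 * M)) ^ 2 with hδ
    have hq0 : 0 ≤ d / (2 * M) := by positivity
    have hsq : √δ = d / (2 * M) := by rw [hδ, Real.sqrt_sq hq0]
    have hMδ : M * √δ ≤ d / 2 := by
      rw [hsq, mul_div_assoc', div_le_iff₀ (by positivity)]; nlinarith
    have hδle : δ ≤ (b - a) / 2 := by
      -- `d/(2M) < √((b-a)/2)`, square both sides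
      have h1 : d / (2 * M) < √((b - a) / 2) := by
        rw [div_lt_iff₀ (by positivity)]; nlinarith
      have h2 := pow_le_pow_left₀ hq0 h1.le 2
      rwa [Real.sq_sqrt (by linarith)] at h2
    have h := mul_le_two_mul_of_deriv_ge hf hfg hε ht (by positivity) hδle (hnear δ (by positivity) hMδ)
    -- `(d/2) · (d/(2M))² = d³/(8M²) ≤ 2ε`
    have h8 : d ^ 3 = 8 * M ^ 2 * (d / 2 * (d / (2 * M)) ^ 2) := by
      field_simp
      ring
    rw [h8]
    nlinarith [h, sq_nonneg M]

/-- **(C2b) — the derivative from the function and a Hölder-½ modulus of the derivative.**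
If `f` is continuous on `[a, b]` (`a < b`) with `|f| ≤ ε` there, `f' = g` on `(a, b)`, and
`|g(x) - g(y)| ≤ M √|x - y|` on `[a, b]` (`M ≥ 0`), then for every `t ∈ [a, b]`:
`|g(t)|³ ≤ 16 ε M²` or `|g(t)| (b - a) ≤ 8 ε`. [folklore · rung (C2b) beneath (COF)] -/
theorem abs_deriv_pow_three_le_of_abs_le_of_holder {f g : ℝ → ℝ} {a b ε M : ℝ} (hab : a < b)
    (hM : 0 ≤ M) (hf : ContinuousOn f (Icc a b)) (hfg : ∀ x ∈ Ioo a b, HasDerivAt f (g x) x)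
    (hε : ∀ x ∈ Icc a b, |f x| ≤ ε)
    (hmod : ∀ x ∈ Icc a b, ∀ y ∈ Icc a b, |g x - g y| ≤ M * √|x - y|) {t : ℝ} (ht : t ∈ Icc a b) :
    |g t| ^ 3 ≤ 16 * ε * M ^ 2 ∨ |g t| * (b - a) ≤ 8 * ε := by
  have hε0 : 0 ≤ ε := (abs_nonneg _).trans (hε t ht)
  rcases lt_trichotomy 0 (g t) with hpos | hzero | hneg
  · rw [abs_of_pos hpos]
    exact deriv_pow_three_le_of_abs_le_of_holder_of_pos hab hM hf hfg hε hmod ht hpos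
  · left
    rw [← hzero, abs_zero]
    have : (0 : ℝ) ^ 3 = 0 := by norm_num
    rw [this]; positivity
  · -- apply the positive case to `(-f, -g)`
    rw [abs_of_neg hneg]
    have hf' : ContinuousOn (fun x => -f x) (Icc a b) := hf.neg
    have hfg' : ∀ x ∈ Ioo a b, HasDerivAt (fun x => -f x) ((fun x => -g x) x) x :=
      fun x hx => (hfg x hx).neg
    have hε' : ∀ x ∈ Icc a b, |(fun x => -f x) x| ≤ ε := fun x hx => by
      simp only [abs_neg]; exact hε x hx
    have hmod' : ∀ x ∈ Icc a b, ∀ y ∈ Icc a b,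
        |(fun x => -g x) x - (fun x => -g x) y| ≤ M * √|x - y| := fun x hx y hy => by
      show |-g x - -g y| ≤ M * √|x - y|
      rw [show -g x - -g y = -(g x - g y) by ring, abs_neg]
      exact hmod x hx y hy
    have h := deriv_pow_three_le_of_abs_le_of_holder_of_pos hab hM hf' hfg' hε' hmod' ht
      (show 0 < -g t by linarith)
    exact h

/-! ## 3. (C2c): the Hölder-½ modulus from an `L²` bound of the derivative -/

/-- Cauchy–Schwarz on an interval, from first principles: for `h` continuous on `[u, t]`,
`(∫ᵤᵗ h)² ≤ (t - u) ∫ᵤᵗ h²`. [folklore] -/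
theorem sq_integral_le_mul_integral_sq {h : ℝ → ℝ} {u t : ℝ} (hut : u ≤ t)
    (hh : ContinuousOn h (Icc u t)) :
    (∫ r in u..t, h r) ^ 2 ≤ (t - u) * ∫ r in u..t, h r ^ 2 := by
  rcases eq_or_lt_of_le hut with heq | hlt
  · subst heq; simp
  have hℓ : 0 < t - u := sub_pos.2 hlt
  set I := ∫ r in u..t, h r with hI
  set J := ∫ r in u..t, h r ^ 2 with hJ
  set m := I / (t - u) with hm
  have hi : IntervalIntegrable (fun r => h r) volume u t := hh.intervalIntegrable_of_Icc hut
  have hi2 : IntervalIntegrable (fun r => h r ^ 2) volume u t :=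
    (hh.pow 2).intervalIntegrable_of_Icc hut
  have him : IntervalIntegrable (fun r => 2 * m * h r) volume u t := hi.const_mul (2 * m)
  have hd : IntervalIntegrable (fun r => h r ^ 2 - 2 * m * h r) volume u t := hi2.sub him
  have hc : IntervalIntegrable (fun _ => m ^ 2) volume u t := intervalIntegrable_const
  have h0 : 0 ≤ ∫ r in u..t, (h r - m) ^ 2 :=
    intervalIntegral.integral_nonneg hut fun r _ => sq_nonneg _
  have hexp : ∫ r in u..t, (h r - m) ^ 2 = J - 2 * m * I + m ^ 2 * (t - u) := by
    have hfun : (fun r => (h r - m) ^ 2) = fun r => (h r ^ 2 - 2 * m * h r) + m ^ 2 := by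
      funext r; ring
    rw [hfun, intervalIntegral.integral_add hd hc, intervalIntegral.integral_sub hi2 him,
      intervalIntegral.integral_const_mul, intervalIntegral.integral_const, smul_eq_mul]
    ring
  have hkey : J - 2 * m * I + m ^ 2 * (t - u) = J - I ^ 2 / (t - u) := by
    rw [hm]; field_simp; ring
  have h1 : I ^ 2 / (t - u) ≤ J := by linarith [h0, hexp, hkey]
  rw [div_le_iff₀ hℓ] at h1
  linarith [h1]

/-- **(C2c) — the Hölder-½ modulus from an `L²` bound of the derivative.**  If `G` is continuous
on `[a, b]` with `G' = h` on `(a, b)` and `h` continuous on `[a, b]`, then for all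
`x, y ∈ [a, b]`: `|G(x) - G(y)| ≤ √(∫ₐᵇ h²) · √|x - y|` — exactly the modulus hypothesis of
`abs_deriv_pow_three_le_of_abs_le_of_holder` with `M = ‖h‖_{L²(a,b)}`.  In the transfer step of
(COF) `G = β̇_j` or `α̇_j` and `∫ h²` is a time integral of a polynomial of the path energy times
`sup ‖c‖²` (budget currency). [folklore · rung (C2c) beneath (COF)] -/
theorem abs_sub_le_sqrt_integral_sq_mul_sqrt {G h : ℝ → ℝ} {a b : ℝ}
    (hGc : ContinuousOn G (Icc a b)) (hGh : ∀ r ∈ Ioo a b, HasDerivAt G (h r) r)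
    (hh : ContinuousOn h (Icc a b)) {x y : ℝ} (hx : x ∈ Icc a b) (hy : y ∈ Icc a b) :
    |G x - G y| ≤ √(∫ r in a..b, h r ^ 2) * √|x - y| := by
  wlog hxy : x ≤ y generalizing x y
  · have h := this hy hx (le_of_not_ge hxy)
    rwa [abs_sub_comm (G y), abs_sub_comm y] at h
  have hsub : Icc x y ⊆ Icc a b := Icc_subset_Icc hx.1 hy.2
  have hftc : ∫ r in x..y, h r = G y - G x :=
    intervalIntegral.integral_eq_sub_of_hasDeriv_right_of_le hxy (hGc.mono hsub)
      (fun r hr => (hGh r ⟨lt_of_le_of_lt hx.1 hr.1, lt_of_lt_of_le hr.2 hy.2⟩).hasDerivWithinAt)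
      ((hh.mono hsub).intervalIntegrable_of_Icc hxy)
  have hcs := sq_integral_le_mul_integral_sq hxy (hh.mono hsub)
  rw [hftc] at hcs
  have hJ : ∫ r in x..y, h r ^ 2 ≤ ∫ r in a..b, h r ^ 2 :=
    intervalIntegral.integral_mono_interval hx.1 hxy hy.2
      (Filter.Eventually.of_forall fun r => sq_nonneg (h r))
      ((hh.pow 2).intervalIntegrable_of_Icc (le_trans hx.1 (hxy.trans hy.2)))
  have hyx : 0 ≤ y - x := sub_nonneg.2 hxy
  have hsq : (G x - G y) ^ 2 ≤ (y - x) * ∫ r in a..b, h r ^ 2 := by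
    have h1 : (G x - G y) ^ 2 = (G y - G x) ^ 2 := by ring
    rw [h1]
    exact hcs.trans (mul_le_mul_of_nonneg_left hJ hyx)
  calc |G x - G y| = √((G x - G y) ^ 2) := (Real.sqrt_sq_eq_abs _).symm
    _ ≤ √((y - x) * ∫ r in a..b, h r ^ 2) := Real.sqrt_le_sqrt hsq
    _ = √(∫ r in a..b, h r ^ 2) * √|x - y| := by
        rw [Real.sqrt_mul hyx, abs_sub_comm, abs_of_nonneg hyx, mul_comm]

end Summit.AtomisticToContinuum.FouriersLaw.Theorems.ExtensiveSnapshotIrreversibility.EnergyWindow
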